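import Mathlib
import Literature.NumberTheory.LFunctions.Zhang2022.RepairBedBlocks
import HarnessLib

/-!
# Zhang (2022), rescue bed (D-0124 (3)) Tier S add-on C-LENX: the COHERENCE statistic of two block directions,
# its abs-weight twin, Cauchy–Schwarz, and the 2×2 block dictionary (bed node G2-04 / N3-C «LENX»; GAP rows G-12·G-23 C2)

Topic `Literature/NumberTheory/LFunctions/Zhang2022` (Landau–Siegel audit tree; verdict-neutral).
Y. Zhang, *Discrete mean estimates and the Landau–Siegel zero*, arXiv:2211.02515v1 (2022) [Zhang2022LandauSiegel] —
**an unrefereed manuscript under adjudication; nothing here asserts or denies any of its claims, and nothing here is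
a claim about Landau–Siegel zeros.** Bed-3's registered reading C-LENX (rescue bus 2026-08-27T10:01:17Z (D)) compares,
per (scale, u, v, θ, D), the scale-free statistic `c = M_uv / √(M_uu·M_vv)` of the 2×2 block
`𝕄 = Σ_ρ Re 𝔠*·Re ω·(H_u, H_v)ᵀ(H̄_u, H̄_v)` (entries `Repair.Bed.gramSum`, `RepairBedBlocks`) with its model value;
R-LENX(u_K) asks whether the genuine block at the kernel mode `u_K = g⋆` (`Repair.gStar`; block `profPolyB S χ ψ
Repair.gStar ⌈P⌉`) is definite, the model block being `[[0, c],[c̄, Re 𝔅_θ(v)]]`. Typed here: `gramSum_self`/`_swap`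
(diagonal real, Hermitian), scalings `gramSum_smul_left/right/self_re`; abs-weight twins `gramAbsTerm`/`gramAbsSum`
(`coefBlockMeanB_eq_gramAbsSum_re`); weighted Cauchy–Schwarz `norm_sum_weight_mul_conj_sq_le` ⇒ `norm_gramSum_sq_le` /
`norm_gramSum_le_sqrt_mul` (SIGN-FENCED: every `Re 𝔠*·Re ω ≥ 0` on `Z` — data, not a theorem, at genuine zeros) and
`norm_gramAbsSum_sq_le` (unconditional); the statistic `coh m d₁ d₂ = m/√(d₁d₂)`, `gramCoh`/`gramAbsCoh`, `‖c‖ ≤ 1`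
under the fence, `‖cᵃᵇˢ‖ ≤ 1` always, `norm_coh_lt_one_iff`/`one_lt_norm_coh_iff`, scale-freeness `coh_smul`,
`norm_gramCoh_smul`; the 2×2 dictionary `blockQuad d₁ d₂ m x y = vᴴ𝕄v`: `blockQuad_gramSum` (Gram identity ⇒ PSD under
the fence), `blockQuad_pos` (Sylvester: PD ⇔ `‖c‖ < 1`), `exists_blockQuad_neg` (`‖c‖ > 1` ⇒ indefinite),
`blockQuad_nonneg_iff` (PSD ⇔ `‖m‖² ≤ d₁d₂`, the uu-slot restoration criterion), `blockQuad_corner_zero_indefinite` /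
`det_corner_zero` / `modelBlock_det_neg` (the MODEL block, `c ≠ 0`, is indefinite for EVERY real `b`). Nothing here
evaluates a block, fixes a threshold (bed-3's ½ / 45° / 8-of-11 rule is the spec's), or asserts a sign of any genuine
weight. No `instance`, no notation.

## References

* Y. Zhang, arXiv:2211.02515v1 (2022), §2 (2.16), (2.23), (2.30); §7 Prop 7.1, (7.2) p.44. [cite: Zhang2022LandauSiegel, §§2, 7]
* R. A. Horn, C. R. Johnson, *Matrix Analysis*, 2nd ed. (2013), §5.1 (Cauchy–Schwarz), §§7.1–7.2 (positive definite
  matrices). [cite: HornJohnson2013, §5.1, §§7.1–7.2]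
-/

noncomputable section

open Complex Real ComplexConjugate

namespace Literature.NumberTheory.LFunctions.Zhang2022.Repair.Bed

section Coherence

variable {S : Scale} {p : ℕ} [NeZero p] {ψ : DirichletCharacter ℂ p}

/-- The per-zero Gram entry is the real WEIGHT `w(ρ) = Re 𝔠*(ρ,ψ)·Re ω(ρ)` times `A ρ·conj(B ρ)`.
[cite: Zhang2022LandauSiegel, §2 (2.16); §7 (7.2) p.44] -/
theorem gramTerm_eq_weight_mul (c' : ℝ) (A B : ℂ → ℂ) (ρ : ℂ) :
    gramTerm S ψ c' A B ρ = (((cstar S ψ c' ρ).re * (omegaW S ρ).re : ℝ) : ℂ) * (A ρ * conj (B ρ)) := by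
  unfold gramTerm; push_cast; ring

/-- The diagonal Gram SUM is real: `M_AA = Σ_{ρ∈Z} Re 𝔠*·‖A ρ‖²·Re ω` (as a real number cast to `ℂ`).
[cite: Zhang2022LandauSiegel, §2 (2.16); §7 (7.2) p.44] -/
theorem gramSum_self (c' : ℝ) (A : ℂ → ℂ) (Z : Finset ℂ) :
    gramSum S ψ c' A A Z = ((∑ ρ ∈ Z, (cstar S ψ c' ρ).re * ‖A ρ‖ ^ 2 * (omegaW S ρ).re : ℝ) : ℂ) := by
  unfold gramSum; rw [Complex.ofReal_sum]; exact Finset.sum_congr rfl fun ρ _ => gramTerm_self c' A ρ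

/-- Real part of the diagonal Gram sum as a weighted sum `Σ w(ρ)·‖A ρ‖²`. [cite: Zhang2022LandauSiegel, §2 (2.16)] -/
theorem gramSum_self_re (c' : ℝ) (A : ℂ → ℂ) (Z : Finset ℂ) :
    (gramSum S ψ c' A A Z).re = ∑ ρ ∈ Z, ((cstar S ψ c' ρ).re * (omegaW S ρ).re) * ‖A ρ‖ ^ 2 := by
  rw [gramSum_self, Complex.ofReal_re]; exact Finset.sum_congr rfl fun ρ _ => by ring

/-- The Gram sum as a weighted Hermitian sum `Σ w(ρ)·A ρ·conj(B ρ)`. [cite: Zhang2022LandauSiegel, §2 (2.16)] -/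
theorem gramSum_eq_weight_sum (c' : ℝ) (A B : ℂ → ℂ) (Z : Finset ℂ) :
    gramSum S ψ c' A B Z = ∑ ρ ∈ Z, (((cstar S ψ c' ρ).re * (omegaW S ρ).re : ℝ) : ℂ) * (A ρ * conj (B ρ)) :=
  Finset.sum_congr rfl fun ρ _ => gramTerm_eq_weight_mul c' A B ρ

/-- Hermitian symmetry of the block: `M_BA = conj M_AB`. [cite: Zhang2022LandauSiegel, §2 (2.16); §7 (7.2) p.44] -/
theorem gramSum_swap (c' : ℝ) (A B : ℂ → ℂ) (Z : Finset ℂ) :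
    gramSum S ψ c' B A Z = conj (gramSum S ψ c' A B Z) := by
  unfold gramSum; rw [map_sum]; exact Finset.sum_congr rfl fun ρ _ => gramTerm_swap c' A B ρ

variable (S ψ) in
/-- **Abs-weighted per-zero Gram entry** `|Re 𝔠*·Re ω|·A ρ·conj(B ρ)` (the sign-free twin used when genuine weights
change sign, as in `RepairBedEndgame`'s abs-weight basis). [cite: Zhang2022LandauSiegel, §2 (2.16); §7 (7.2) p.44] -/
def gramAbsTerm (c' : ℝ) (A B : ℂ → ℂ) (ρ : ℂ) : ℂ :=
  ((|(cstar S ψ c' ρ).re * (omegaW S ρ).re| : ℝ) : ℂ) * (A ρ * conj (B ρ))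

variable (S ψ) in
/-- Abs-weighted Gram entry summed over an explicit finite zero set. [cite: Zhang2022LandauSiegel, §2 (2.16)] -/
def gramAbsSum (c' : ℝ) (A B : ℂ → ℂ) (Z : Finset ℂ) : ℂ := ∑ ρ ∈ Z, gramAbsTerm S ψ c' A B ρ

/-- The abs-weighted diagonal sum is real and equals `Σ |w|·‖A ρ‖²`; for a coefficient block it is `coefBlockMeanB`.
[cite: Zhang2022LandauSiegel, §2 (2.16); §7 (7.2) p.44] -/
theorem gramAbsSum_self (c' : ℝ) (A : ℂ → ℂ) (Z : Finset ℂ) :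
    gramAbsSum S ψ c' A A Z = ((∑ ρ ∈ Z, |(cstar S ψ c' ρ).re * (omegaW S ρ).re| * ‖A ρ‖ ^ 2 : ℝ) : ℂ) := by
  unfold gramAbsSum gramAbsTerm
  rw [Complex.ofReal_sum]
  refine Finset.sum_congr rfl fun ρ _ => ?_
  rw [Complex.mul_conj, Complex.normSq_eq_norm_sq]; push_cast; ring

/-- `coefBlockMeanB` is the abs-weighted diagonal Gram sum of the block map `ρ ↦ B(a; M, N; ψ, ρ)`.
[cite: Zhang2022LandauSiegel, §2 (2.16)–(2.20)] -/
theorem coefBlockMeanB_eq_gramAbsSum_re {D : ℕ} (χ : DirichletCharacter ℂ D) (c' : ℝ) (a : ℕ → ℂ) (M N : ℕ)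
    (Z : Finset ℂ) :
    coefBlockMeanB S χ ψ c' a M N Z = (gramAbsSum S ψ c' (coefBlockB χ ψ a M N) (coefBlockB χ ψ a M N) Z).re := by
  rw [gramAbsSum_self, Complex.ofReal_re]; rfl

/-- Hermitian symmetry of the abs-weighted block. [cite: Zhang2022LandauSiegel, §2 (2.16)] -/
theorem gramAbsSum_swap (c' : ℝ) (A B : ℂ → ℂ) (Z : Finset ℂ) :
    gramAbsSum S ψ c' B A Z = conj (gramAbsSum S ψ c' A B Z) := by
  unfold gramAbsSum gramAbsTerm
  rw [map_sum]
  refine Finset.sum_congr rfl fun ρ _ => ?_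
  simp only [map_mul, Complex.conj_ofReal, Complex.conj_conj]; ring

/-- **Weighted Cauchy–Schwarz for finite Hermitian sums with NONNEGATIVE weights**:
`‖Σ w·a·conj b‖² ≤ (Σ w‖a‖²)(Σ w‖b‖²)`. [cite: HornJohnson2013, §5.1 (Cauchy–Schwarz inequality)] -/
theorem norm_sum_weight_mul_conj_sq_le {ι : Type*} (s : Finset ι) (w : ι → ℝ) (a b : ι → ℂ)
    (hw : ∀ i ∈ s, 0 ≤ w i) :
    ‖∑ i ∈ s, ((w i : ℝ) : ℂ) * (a i * conj (b i))‖ ^ 2 ≤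
      (∑ i ∈ s, w i * ‖a i‖ ^ 2) * (∑ i ∈ s, w i * ‖b i‖ ^ 2) := by
  have h1 : ‖∑ i ∈ s, ((w i : ℝ) : ℂ) * (a i * conj (b i))‖ ≤
      ∑ i ∈ s, (Real.sqrt (w i) * ‖a i‖) * (Real.sqrt (w i) * ‖b i‖) := by
    refine (norm_sum_le _ _).trans (le_of_eq (Finset.sum_congr rfl fun i hi => ?_))
    rw [norm_mul, norm_mul, Complex.norm_conj, Complex.norm_real, Real.norm_of_nonneg (hw i hi)]
    have hs : Real.sqrt (w i) * Real.sqrt (w i) = w i := Real.mul_self_sqrt (hw i hi)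
    calc w i * (‖a i‖ * ‖b i‖) = (Real.sqrt (w i) * Real.sqrt (w i)) * (‖a i‖ * ‖b i‖) := by rw [hs]
      _ = Real.sqrt (w i) * ‖a i‖ * (Real.sqrt (w i) * ‖b i‖) := by ring
  have h2 := Finset.sum_mul_sq_le_sq_mul_sq s (fun i => Real.sqrt (w i) * ‖a i‖) (fun i => Real.sqrt (w i) * ‖b i‖)
  have h3 : ∀ (f : ι → ℂ), ∑ i ∈ s, (Real.sqrt (w i) * ‖f i‖) ^ 2 = ∑ i ∈ s, w i * ‖f i‖ ^ 2 := fun f => by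
    refine Finset.sum_congr rfl fun i hi => ?_
    rw [mul_pow, Real.sq_sqrt (hw i hi)]
  rw [h3 a, h3 b] at h2
  exact (pow_le_pow_left₀ (norm_nonneg _) h1 2).trans h2

/-- **Cauchy–Schwarz for the SIGNED block, sign-fenced**: if every weight `Re 𝔠*(ρ,ψ)·Re ω(ρ)`, `ρ ∈ Z`, is `≥ 0`, then
`‖M_AB‖² ≤ M_AA·M_BB`. (At genuine zeros the weights change sign and the hypothesis is data, not a theorem.)
[cite: Zhang2022LandauSiegel, §2 (2.16); §7 (7.2) p.44] -/
theorem norm_gramSum_sq_le (c' : ℝ) (A B : ℂ → ℂ) (Z : Finset ℂ)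
    (hw : ∀ ρ ∈ Z, 0 ≤ (cstar S ψ c' ρ).re * (omegaW S ρ).re) :
    ‖gramSum S ψ c' A B Z‖ ^ 2 ≤ (gramSum S ψ c' A A Z).re * (gramSum S ψ c' B B Z).re := by
  rw [gramSum_eq_weight_sum, gramSum_self_re, gramSum_self_re]
  exact norm_sum_weight_mul_conj_sq_le Z _ A B hw

/-- **Cauchy–Schwarz for the ABS-WEIGHTED block, unconditional**: `‖Mᵃᵇˢ_AB‖² ≤ Mᵃᵇˢ_AA·Mᵃᵇˢ_BB`.
[cite: Zhang2022LandauSiegel, §2 (2.16); §7 (7.2) p.44] -/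
theorem norm_gramAbsSum_sq_le (c' : ℝ) (A B : ℂ → ℂ) (Z : Finset ℂ) :
    ‖gramAbsSum S ψ c' A B Z‖ ^ 2 ≤ (gramAbsSum S ψ c' A A Z).re * (gramAbsSum S ψ c' B B Z).re := by
  have hdiag : ∀ (F : ℂ → ℂ), (gramAbsSum S ψ c' F F Z).re =
      ∑ ρ ∈ Z, |(cstar S ψ c' ρ).re * (omegaW S ρ).re| * ‖F ρ‖ ^ 2 := fun F => by rw [gramAbsSum_self, Complex.ofReal_re]
  rw [hdiag A, hdiag B]; exact norm_sum_weight_mul_conj_sq_le Z _ A B fun ρ _ => abs_nonneg _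

/-- The fenced CS in square-root form (the name the quantifier's notes use): `‖M_AB‖ ≤ √(M_AA·M_BB)` when every
weight on `Z` is nonnegative. [cite: Zhang2022LandauSiegel, §2 (2.16); §7 (7.2) p.44] -/
theorem norm_gramSum_le_sqrt_mul (c' : ℝ) (A B : ℂ → ℂ) (Z : Finset ℂ)
    (hw : ∀ ρ ∈ Z, 0 ≤ (cstar S ψ c' ρ).re * (omegaW S ρ).re) :
    ‖gramSum S ψ c' A B Z‖ ≤ Real.sqrt ((gramSum S ψ c' A A Z).re * (gramSum S ψ c' B B Z).re) := by
  rw [← Real.sqrt_sq (norm_nonneg (gramSum S ψ c' A B Z))]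
  exact Real.sqrt_le_sqrt (norm_gramSum_sq_le c' A B Z hw)

/-- Scaling a block direction scales the Gram sum: `M_{aA,B} = a·M_{AB}`. [cite: Zhang2022LandauSiegel, §2 (2.16)] -/
theorem gramSum_smul_left (c' : ℝ) (a : ℂ) (A B : ℂ → ℂ) (Z : Finset ℂ) :
    gramSum S ψ c' (fun ρ => a * A ρ) B Z = a * gramSum S ψ c' A B Z := by
  unfold gramSum gramTerm; rw [Finset.mul_sum]; exact Finset.sum_congr rfl fun ρ _ => by ring

/-- `M_{A,bB} = conj b·M_{AB}`. [cite: Zhang2022LandauSiegel, §2 (2.16)] -/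
theorem gramSum_smul_right (c' : ℝ) (b : ℂ) (A B : ℂ → ℂ) (Z : Finset ℂ) :
    gramSum S ψ c' A (fun ρ => b * B ρ) Z = conj b * gramSum S ψ c' A B Z := by
  unfold gramSum gramTerm; rw [Finset.mul_sum]; exact Finset.sum_congr rfl fun ρ _ => by rw [map_mul]; ring

/-- `M_{aA,aA} = ‖a‖²·M_{AA}` on real parts. [cite: Zhang2022LandauSiegel, §2 (2.16)] -/
theorem gramSum_smul_self_re (c' : ℝ) (a : ℂ) (A : ℂ → ℂ) (Z : Finset ℂ) :
    (gramSum S ψ c' (fun ρ => a * A ρ) (fun ρ => a * A ρ) Z).re = ‖a‖ ^ 2 * (gramSum S ψ c' A A Z).re := by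
  rw [gramSum_smul_left, gramSum_smul_right, ← mul_assoc, Complex.mul_conj, Complex.normSq_eq_norm_sq,
    Complex.re_ofReal_mul]

/-! ### The scale-free coherence statistic `c = M_AB/√(M_AA·M_BB)` -/

/-- The coherence statistic of an off-diagonal entry `m` against two real diagonal entries:
`coh m d₁ d₂ = m / √(d₁·d₂)` (junk value `0` when `d₁·d₂ ≤ 0`, by `Real.sqrt` and division by zero — a bed row
prints `c` only for positive diagonal entries). [cite: Zhang2022LandauSiegel, §2 (2.16); §7 (7.2) p.44] -/
def coh (m : ℂ) (d₁ d₂ : ℝ) : ℂ := m / ((Real.sqrt (d₁ * d₂) : ℝ) : ℂ)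

/-- `‖coh m d₁ d₂‖ = ‖m‖/√(d₁d₂)`. [cite: Zhang2022LandauSiegel, §2 (2.16); §7 (7.2) p.44] -/
theorem norm_coh (m : ℂ) (d₁ d₂ : ℝ) : ‖coh m d₁ d₂‖ = ‖m‖ / Real.sqrt (d₁ * d₂) := by
  rw [coh, norm_div, Complex.norm_real, Real.norm_of_nonneg (Real.sqrt_nonneg _)]

/-- CS in coherence form: `‖m‖² ≤ d₁d₂ ⇒ ‖coh m d₁ d₂‖ ≤ 1`. [cite: HornJohnson2013, §5.1 (Cauchy–Schwarz inequality)] -/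
theorem norm_coh_le_one_of_sq_le {m : ℂ} {d₁ d₂ : ℝ} (h : ‖m‖ ^ 2 ≤ d₁ * d₂) : ‖coh m d₁ d₂‖ ≤ 1 := by
  have hle : ‖m‖ ≤ Real.sqrt (d₁ * d₂) := by rw [← Real.sqrt_sq (norm_nonneg m)]; exact Real.sqrt_le_sqrt h
  rw [norm_coh]; exact div_le_one_of_le₀ hle (Real.sqrt_nonneg _)

/-- For positive diagonal entries, `‖coh m d₁ d₂‖ < 1 ↔ ‖m‖² < d₁·d₂` (strict CS ⇔ the signed 2×2 block is positive
definite, `blockQuad_pos` below). [cite: HornJohnson2013, §7.1–7.2 (positive definite 2×2 Hermitian blocks)] -/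
theorem norm_coh_lt_one_iff {m : ℂ} {d₁ d₂ : ℝ} (h₁ : 0 < d₁) (h₂ : 0 < d₂) :
    ‖coh m d₁ d₂‖ < 1 ↔ ‖m‖ ^ 2 < d₁ * d₂ := by
  have hpos : 0 < Real.sqrt (d₁ * d₂) := Real.sqrt_pos.2 (mul_pos h₁ h₂)
  have hr2 : Real.sqrt (d₁ * d₂) ^ 2 = d₁ * d₂ := Real.sq_sqrt (mul_pos h₁ h₂).le
  rw [norm_coh, div_lt_one hpos]
  exact ⟨fun h => by nlinarith [norm_nonneg m, h, hpos, hr2], fun h => by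
    by_contra hc; nlinarith [norm_nonneg m, (not_lt.mp hc : Real.sqrt (d₁ * d₂) ≤ ‖m‖), hpos, hr2]⟩

/-- For positive diagonal entries, `1 < ‖coh m d₁ d₂‖ ↔ d₁·d₂ < ‖m‖²` (CS violated ⇔ the signed block is indefinite,
`exists_blockQuad_neg` below). [cite: HornJohnson2013, §7.1–7.2 (positive definite 2×2 Hermitian blocks)] -/
theorem one_lt_norm_coh_iff {m : ℂ} {d₁ d₂ : ℝ} (h₁ : 0 < d₁) (h₂ : 0 < d₂) :
    1 < ‖coh m d₁ d₂‖ ↔ d₁ * d₂ < ‖m‖ ^ 2 := by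
  have hpos : 0 < Real.sqrt (d₁ * d₂) := Real.sqrt_pos.2 (mul_pos h₁ h₂)
  have hr2 : Real.sqrt (d₁ * d₂) ^ 2 = d₁ * d₂ := Real.sq_sqrt (mul_pos h₁ h₂).le
  rw [norm_coh, one_lt_div hpos]
  exact ⟨fun h => by nlinarith [norm_nonneg m, h, hpos, hr2], fun h => by
    by_contra hc; nlinarith [norm_nonneg m, (not_lt.mp hc : ‖m‖ ≤ Real.sqrt (d₁ * d₂)), hpos, hr2]⟩

/-- **Scale covariance of the statistic**: rescaling the two directions by nonzero scalars `a, b` multiplies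
`coh` by the PHASE `a·conj b/(‖a‖‖b‖)`: `coh (a·conj b·m) (‖a‖²d₁) (‖b‖²d₂) = (a·conj b/(‖a‖‖b‖))·coh m d₁ d₂`.
[cite: HornJohnson2013, §7.1–7.2 (positive definite 2×2 Hermitian blocks)] -/
theorem coh_smul {a b : ℂ} (ha : a ≠ 0) (hb : b ≠ 0) (m : ℂ) (d₁ d₂ : ℝ) :
    coh (a * conj b * m) (‖a‖ ^ 2 * d₁) (‖b‖ ^ 2 * d₂) = a * conj b / (((‖a‖ * ‖b‖ : ℝ)) : ℂ) * coh m d₁ d₂ := by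
  have hab : 0 < ‖a‖ * ‖b‖ := mul_pos (norm_pos_iff.2 ha) (norm_pos_iff.2 hb)
  have hs : Real.sqrt (‖a‖ ^ 2 * d₁ * (‖b‖ ^ 2 * d₂)) = ‖a‖ * ‖b‖ * Real.sqrt (d₁ * d₂) := by
    rw [show ‖a‖ ^ 2 * d₁ * (‖b‖ ^ 2 * d₂) = (‖a‖ * ‖b‖) ^ 2 * (d₁ * d₂) by ring,
      Real.sqrt_mul (sq_nonneg _), Real.sqrt_sq hab.le]
  unfold coh; rw [hs, Complex.ofReal_mul]
  have hne : (((‖a‖ * ‖b‖ : ℝ)) : ℂ) ≠ 0 := Complex.ofReal_ne_zero.2 hab.ne'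
  by_cases hd : Real.sqrt (d₁ * d₂) = 0
  · simp [hd]
  · have hd' : ((Real.sqrt (d₁ * d₂) : ℝ) : ℂ) ≠ 0 := Complex.ofReal_ne_zero.2 hd
    field_simp

/-- Hence `‖coh‖` is SCALE-FREE: `‖coh (a·conj b·m) (‖a‖²d₁) (‖b‖²d₂)‖ = ‖coh m d₁ d₂‖` for `a, b ≠ 0` — the reason
bed-3's `|c|` is immune to the per-`D` normalisation of the block (quant-1 10:09:04Z).
[cite: HornJohnson2013, §7.1–7.2 (positive definite 2×2 Hermitian blocks)] -/
theorem norm_coh_smul {a b : ℂ} (ha : a ≠ 0) (hb : b ≠ 0) (m : ℂ) (d₁ d₂ : ℝ) :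
    ‖coh (a * conj b * m) (‖a‖ ^ 2 * d₁) (‖b‖ ^ 2 * d₂)‖ = ‖coh m d₁ d₂‖ := by
  have hab : 0 < ‖a‖ * ‖b‖ := mul_pos (norm_pos_iff.2 ha) (norm_pos_iff.2 hb)
  rw [coh_smul ha hb, norm_mul, norm_div, norm_mul, Complex.norm_conj, Complex.norm_real,
    Real.norm_of_nonneg hab.le, div_self hab.ne', one_mul]

variable (S ψ) in
/-- **The C-LENX statistic of the SIGNED block**: `c(A,B) = M_AB / √(M_AA·M_BB)` over the explicit zero set `Z`.
[cite: Zhang2022LandauSiegel, §2 (2.16); §7 (7.2) p.44] -/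
def gramCoh (c' : ℝ) (A B : ℂ → ℂ) (Z : Finset ℂ) : ℂ :=
  coh (gramSum S ψ c' A B Z) (gramSum S ψ c' A A Z).re (gramSum S ψ c' B B Z).re

variable (S ψ) in
/-- **The C-LENX statistic of the ABS-WEIGHTED block**: `cᵃᵇˢ(A,B) = Mᵃᵇˢ_AB / √(Mᵃᵇˢ_AA·Mᵃᵇˢ_BB)`.
[cite: Zhang2022LandauSiegel, §2 (2.16); §7 (7.2) p.44] -/
def gramAbsCoh (c' : ℝ) (A B : ℂ → ℂ) (Z : Finset ℂ) : ℂ :=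
  coh (gramAbsSum S ψ c' A B Z) (gramAbsSum S ψ c' A A Z).re (gramAbsSum S ψ c' B B Z).re

/-- `‖c(A,B)‖ ≤ 1` for the signed block WHEN all weights on `Z` are nonnegative (sign-fenced CS).
[cite: Zhang2022LandauSiegel, §2 (2.16); §7 (7.2) p.44] -/
theorem norm_gramCoh_le_one (c' : ℝ) (A B : ℂ → ℂ) (Z : Finset ℂ)
    (hw : ∀ ρ ∈ Z, 0 ≤ (cstar S ψ c' ρ).re * (omegaW S ρ).re) : ‖gramCoh S ψ c' A B Z‖ ≤ 1 :=
  norm_coh_le_one_of_sq_le (norm_gramSum_sq_le c' A B Z hw)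

/-- `‖cᵃᵇˢ(A,B)‖ ≤ 1` unconditionally. [cite: Zhang2022LandauSiegel, §2 (2.16); §7 (7.2) p.44] -/
theorem norm_gramAbsCoh_le_one (c' : ℝ) (A B : ℂ → ℂ) (Z : Finset ℂ) : ‖gramAbsCoh S ψ c' A B Z‖ ≤ 1 :=
  norm_coh_le_one_of_sq_le (norm_gramAbsSum_sq_le c' A B Z)

/-- **`gramCoh` under rescaling of the two directions** (`a, b ≠ 0`): `c(aA, bB) = (a·conj b/(‖a‖‖b‖))·c(A, B)`.
[cite: Zhang2022LandauSiegel, §2 (2.16); §7 (7.2) p.44] -/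
theorem gramCoh_smul (c' : ℝ) {a b : ℂ} (ha : a ≠ 0) (hb : b ≠ 0) (A B : ℂ → ℂ) (Z : Finset ℂ) :
    gramCoh S ψ c' (fun ρ => a * A ρ) (fun ρ => b * B ρ) Z =
      a * conj b / (((‖a‖ * ‖b‖ : ℝ)) : ℂ) * gramCoh S ψ c' A B Z := by
  unfold gramCoh
  rw [gramSum_smul_self_re, gramSum_smul_self_re, gramSum_smul_left, gramSum_smul_right, ← mul_assoc,
    coh_smul ha hb]

/-- **The C-LENX statistic is scale-free in norm**: `‖c(aA, bB)‖ = ‖c(A, B)‖` for `a, b ≠ 0`.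
[cite: Zhang2022LandauSiegel, §2 (2.16); §7 (7.2) p.44] -/
theorem norm_gramCoh_smul (c' : ℝ) {a b : ℂ} (ha : a ≠ 0) (hb : b ≠ 0) (A B : ℂ → ℂ) (Z : Finset ℂ) :
    ‖gramCoh S ψ c' (fun ρ => a * A ρ) (fun ρ => b * B ρ) Z‖ = ‖gramCoh S ψ c' A B Z‖ := by
  unfold gramCoh
  rw [gramSum_smul_self_re, gramSum_smul_self_re, gramSum_smul_left, gramSum_smul_right, ← mul_assoc,
    norm_coh_smul ha hb]

/-! ### The 2×2 block dictionary: quadratic form of `[[d₁, m],[m̄, d₂]]` -/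

/-- The Hermitian quadratic form of the 2×2 block `[[d₁, m],[conj m, d₂]]` (real diagonal) at `(x, y) ∈ ℂ²`:
`q(x,y) = d₁‖x‖² + 2·Re(conj x·m·y) + d₂‖y‖²` (`= vᴴ 𝕄 v`).
[cite: HornJohnson2013, §7.1–7.2 (positive definite 2×2 Hermitian blocks)] -/
def blockQuad (d₁ d₂ : ℝ) (m : ℂ) (x y : ℂ) : ℝ := d₁ * ‖x‖ ^ 2 + 2 * (conj x * m * y).re + d₂ * ‖y‖ ^ 2

/-- `blockQuad` is additive in the block data `(d₁, d₂, m)` (a sum of blocks has the sum of the forms).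
[cite: HornJohnson2013, §7.1–7.2 (positive definite 2×2 Hermitian blocks)] -/
theorem blockQuad_sum {ι : Type*} (s : Finset ι) (d₁ d₂ : ι → ℝ) (m : ι → ℂ) (x y : ℂ) :
    blockQuad (∑ i ∈ s, d₁ i) (∑ i ∈ s, d₂ i) (∑ i ∈ s, m i) x y = ∑ i ∈ s, blockQuad (d₁ i) (d₂ i) (m i) x y := by
  unfold blockQuad
  rw [Finset.sum_mul, Finset.sum_mul, Finset.mul_sum, Finset.sum_mul, Complex.re_sum, Finset.mul_sum,
    ← Finset.sum_add_distrib, ← Finset.sum_add_distrib]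

/-- One weighted rank-one block: `blockQuad (w‖a‖²) (w‖b‖²) (w·a·conj b) x y = w·‖conj x·a + conj y·b‖²`.
[cite: HornJohnson2013, §7.1–7.2 (positive definite 2×2 Hermitian blocks)] -/
theorem blockQuad_rankOne (w : ℝ) (a b x y : ℂ) :
    blockQuad (w * ‖a‖ ^ 2) (w * ‖b‖ ^ 2) (((w : ℝ) : ℂ) * (a * conj b)) x y = w * ‖conj x * a + conj y * b‖ ^ 2 := by
  have e : ‖conj x * a + conj y * b‖ ^ 2 =
      ‖x‖ ^ 2 * ‖a‖ ^ 2 + 2 * (conj x * (a * conj b) * y).re + ‖y‖ ^ 2 * ‖b‖ ^ 2 := by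
    rw [← Complex.normSq_eq_norm_sq, ← Complex.normSq_eq_norm_sq, ← Complex.normSq_eq_norm_sq,
      ← Complex.normSq_eq_norm_sq, ← Complex.normSq_eq_norm_sq]
    simp only [Complex.normSq_apply, Complex.add_re, Complex.add_im, Complex.mul_re, Complex.mul_im,
      Complex.conj_re, Complex.conj_im]
    ring
  have e2 : conj x * (((w : ℝ) : ℂ) * (a * conj b)) * y = ((w : ℝ) : ℂ) * (conj x * (a * conj b) * y) := by ring
  rw [e, blockQuad, e2, Complex.re_ofReal_mul]
  ring

/-- **Gram identity**: the quadratic form of the signed block `(M_AA, M_BB, M_AB)` at `(x,y)` is the diagonal Gram sum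
of the combined direction `ρ ↦ conj x·A ρ + conj y·B ρ` — so with nonnegative weights the block is positive
SEMI-definite. [cite: Zhang2022LandauSiegel, §2 (2.16); §7 (7.2) p.44] -/
theorem blockQuad_gramSum (c' : ℝ) (A B : ℂ → ℂ) (Z : Finset ℂ) (x y : ℂ) :
    blockQuad (gramSum S ψ c' A A Z).re (gramSum S ψ c' B B Z).re (gramSum S ψ c' A B Z) x y =
      (gramSum S ψ c' (fun ρ => conj x * A ρ + conj y * B ρ) (fun ρ => conj x * A ρ + conj y * B ρ) Z).re := by
  rw [gramSum_self_re, gramSum_self_re, gramSum_eq_weight_sum, gramSum_self_re, blockQuad_sum]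
  exact Finset.sum_congr rfl fun ρ _ => blockQuad_rankOne _ _ _ _ _

/-- Completing the square: `d₁·q(x,y) = ‖d₁x + m y‖² + (d₁d₂ − ‖m‖²)‖y‖²`.
[cite: HornJohnson2013, §7.1–7.2 (positive definite 2×2 Hermitian blocks)] -/
theorem mul_blockQuad_eq (d₁ d₂ : ℝ) (m x y : ℂ) :
    d₁ * blockQuad d₁ d₂ m x y = ‖(d₁ : ℂ) * x + m * y‖ ^ 2 + (d₁ * d₂ - ‖m‖ ^ 2) * ‖y‖ ^ 2 := by
  simp only [blockQuad, ← Complex.normSq_eq_norm_sq, Complex.normSq_apply, Complex.add_re, Complex.add_im,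
    Complex.mul_re, Complex.mul_im, Complex.conj_re, Complex.conj_im, Complex.ofReal_re, Complex.ofReal_im]
  ring

/-- **PD criterion (Sylvester, 2×2)**: `d₁ > 0` and `‖m‖² < d₁d₂` ⇒ `q(x,y) > 0` for every `(x,y) ≠ (0,0)` — the signed
data block is positive definite iff `‖c‖ < 1` (`norm_coh_lt_one_iff`).
[cite: HornJohnson2013, §7.1–7.2 (positive definite 2×2 Hermitian blocks)] -/
theorem blockQuad_pos {d₁ d₂ : ℝ} {m : ℂ} (h₁ : 0 < d₁) (hm : ‖m‖ ^ 2 < d₁ * d₂) (x y : ℂ) (hxy : x ≠ 0 ∨ y ≠ 0) :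
    0 < blockQuad d₁ d₂ m x y := by
  by_cases hy : y = 0
  · subst hy
    have hx : x ≠ 0 := hxy.resolve_right fun h => h rfl
    simp only [blockQuad, mul_zero, Complex.zero_re, norm_zero, ne_eq, OfNat.ofNat_ne_zero,
      not_false_eq_true, zero_pow, add_zero]
    exact mul_pos h₁ (by positivity)
  · have : 0 < (d₁ * d₂ - ‖m‖ ^ 2) * ‖y‖ ^ 2 := mul_pos (by linarith) (by positivity)
    nlinarith [mul_blockQuad_eq d₁ d₂ m x y, sq_nonneg ‖(d₁ : ℂ) * x + m * y‖]

/-- **Indefinite when CS fails**: `d₁ > 0` and `d₁d₂ < ‖m‖²` ⇒ `q(−m/d₁, 1) < 0` — a signed data block with `‖c‖ > 1`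
(`one_lt_norm_coh_iff`) is indefinite. [cite: HornJohnson2013, §7.1–7.2 (positive definite 2×2 Hermitian blocks)] -/
theorem exists_blockQuad_neg {d₁ d₂ : ℝ} {m : ℂ} (h₁ : 0 < d₁) (hm : d₁ * d₂ < ‖m‖ ^ 2) :
    blockQuad d₁ d₂ m (-m / d₁) 1 < 0 := by
  have key : d₁ * blockQuad d₁ d₂ m (-m / d₁) 1 = d₁ * d₂ - ‖m‖ ^ 2 := by
    have hd : (d₁ : ℂ) ≠ 0 := Complex.ofReal_ne_zero.2 h₁.ne'
    simp only [blockQuad, mul_one, norm_one, one_pow, norm_div, norm_neg, Complex.norm_real,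
      Real.norm_of_nonneg h₁.le]
    have e1 : (conj (-m / (d₁ : ℂ)) * m).re = -(‖m‖ ^ 2) / d₁ := by
      rw [map_div₀, map_neg, Complex.conj_ofReal, neg_div, neg_mul, Complex.neg_re, div_mul_eq_mul_div,
        Complex.conj_mul', ← Complex.ofReal_pow, ← Complex.ofReal_div, Complex.ofReal_re, neg_div]
    rw [e1]; field_simp; ring
  nlinarith [key, hm, h₁]

/-- **The MODEL block is indefinite**: for `d₁ = 0` (at the kernel mode `u_K = g⋆` the (A)-world diagonal main term
`𝔅(g⋆)` vanishes, `Repair.mainTermForm_gStar`), `m = c ≠ 0` and ANY real `d₂`: `q(s·c, 1) = 2s‖c‖² + d₂` takes the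
value `+1` at `s = (1 − d₂)/(2‖c‖²)` and `−1` at `s = (−1 − d₂)/(2‖c‖²)`; in particular `det = −‖c‖² < 0`. This is the
well-posedness of bed-3's R-LENX(u_K) «restoration» question (model indefinite; is the genuine block definite?).
[cite: HornJohnson2013, §7.1–7.2 (positive definite 2×2 Hermitian blocks)] -/
theorem blockQuad_corner_zero_indefinite {m : ℂ} (hm : m ≠ 0) (d₂ : ℝ) :
    blockQuad 0 d₂ m ((((1 - d₂) / (2 * ‖m‖ ^ 2) : ℝ) : ℂ) * m) 1 = 1 ∧
      blockQuad 0 d₂ m ((((-1 - d₂) / (2 * ‖m‖ ^ 2) : ℝ) : ℂ) * m) 1 = -1 := by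
  have hn : 0 < ‖m‖ ^ 2 := by positivity
  have e : ∀ s : ℝ, blockQuad 0 d₂ m (((s : ℝ) : ℂ) * m) 1 = 2 * s * ‖m‖ ^ 2 + d₂ := fun s => by
    simp only [blockQuad, zero_mul, zero_add, mul_one, norm_one, one_pow, map_mul, Complex.conj_ofReal,
      mul_assoc, Complex.re_ofReal_mul, Complex.conj_mul', ← Complex.ofReal_pow, Complex.ofReal_re]
  refine ⟨?_, ?_⟩ <;> rw [e] <;> field_simp <;> ring

/-- **PSD criterion / the uu-slot restoration criterion** (quant-1 10:09:04Z): for `d₁, d₂ ≥ 0` the block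
`[[d₁, m],[m̄, d₂]]` is positive SEMI-definite iff `‖m‖² ≤ d₁·d₂`; read at the kernel mode: `[[0,c],[c̄,b]] + diag(μ,0)`
(`μ, b ≥ 0`) is PSD iff `μ·b ≥ ‖c‖²`. [cite: HornJohnson2013, §7.1–7.2 (positive definite 2×2 Hermitian blocks)] -/
theorem blockQuad_nonneg_iff {d₁ d₂ : ℝ} {m : ℂ} (h₁ : 0 ≤ d₁) (h₂ : 0 ≤ d₂) :
    (∀ x y, 0 ≤ blockQuad d₁ d₂ m x y) ↔ ‖m‖ ^ 2 ≤ d₁ * d₂ := by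
  constructor
  · intro h
    by_contra hlt
    have hlt' : d₁ * d₂ < ‖m‖ ^ 2 := not_le.mp hlt
    rcases h₁.lt_or_eq with hpos | hzero
    · exact absurd (h (-m / d₁) 1) (not_le.mpr (exists_blockQuad_neg hpos hlt'))
    · subst hzero
      have hm : m ≠ 0 := by intro hm; subst hm; simp at hlt'
      have := (blockQuad_corner_zero_indefinite hm d₂).2
      linarith [h ((((-1 - d₂) / (2 * ‖m‖ ^ 2) : ℝ) : ℂ) * m) 1]
  · intro h x y
    rcases h₁.lt_or_eq with hpos | hzero
    · have : 0 ≤ (d₁ * d₂ - ‖m‖ ^ 2) * ‖y‖ ^ 2 := mul_nonneg (by linarith) (by positivity)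
      nlinarith [mul_blockQuad_eq d₁ d₂ m x y, sq_nonneg ‖(d₁ : ℂ) * x + m * y‖]
    · subst hzero
      have hm : m = 0 := by
        have : ‖m‖ ^ 2 ≤ 0 := by simpa using h
        exact norm_eq_zero.mp (by nlinarith [norm_nonneg m])
      subst hm
      simp only [blockQuad, zero_mul, mul_zero, Complex.zero_re, zero_add]
      positivity

/-- `det [[0, c],[c̄, b]] = −‖c‖²` (negative for `c ≠ 0`, whatever the real `b`).
[cite: HornJohnson2013, §7.1–7.2 (positive definite 2×2 Hermitian blocks)] -/
theorem det_corner_zero (c : ℂ) (b : ℝ) :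
    Matrix.det !![(0 : ℂ), c; conj c, (b : ℂ)] = -((‖c‖ ^ 2 : ℝ) : ℂ) := by
  rw [Matrix.det_fin_two_of, zero_mul, zero_sub, Complex.mul_conj, Complex.normSq_eq_norm_sq]

/-- The model block's determinant is NEGATIVE for `c ≠ 0` (every real `b`): `Re det [[0,c],[c̄,b]] = −‖c‖² < 0`
(the name the quantifier's notes use). [cite: HornJohnson2013, §7.1–7.2 (positive definite 2×2 Hermitian blocks)] -/
theorem modelBlock_det_neg {c : ℂ} (hc : c ≠ 0) (b : ℝ) :
    (Matrix.det !![(0 : ℂ), c; conj c, (b : ℂ)]).re < 0 := by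
  rw [det_corner_zero, Complex.neg_re, Complex.ofReal_re, neg_lt_zero]
  positivity

end Coherence

end Literature.NumberTheory.LFunctions.Zhang2022.Repair.Bed
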